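import Literature.MathematicalPhysics.QuantumFieldTheory.Balaban1983to89.Node00.Record13BgRowAtDatumUOfClassC1
import Literature.MathematicalPhysics.QuantumFieldTheory.Balaban1983to89.Node00.Record13ReverseComparabilityOfBetaBox
import Literature.MathematicalPhysics.QuantumFieldTheory.Balaban1983to89.Node00.Record12BgRowCoClassC

/-!
# NODE 00 (YM-PLAN Track A) — STAGE 13: FILE 14c §3 RE-KEYED TO THE C′ FACT `VariationalThm1RegSepCo7` (two-sided threshold comparability; dag-n07-e LOCATED-M4 + INTENT-C′): AT `θ₁₅ᶜᶜ¹`,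
# the C⁰ bound and ★★★ row P11's body for EVERY MINIMISER over print's class (6), the new input (hcompRev) DISPLAYED or DISCHARGED by FILE 14d's two-sided β-box lemma

Cell `pub-ymgap`, seat `pub-ymgap-node00-def-K0a` (g7), FILE 14f (sequel of 14c `Record13BgRowAtDatumUOfClassC1` §3 — keyed on the located-negative `…Co6`, vacuous as typed — and of
14d `Record13ReverseComparabilityOfBetaBox`).  [15] = [Balaban1985Variational], [6] = [Balaban1985RegularSpaces], [III] = [Balaban1988Convergent], [I] = [Balaban1987RG1].

WHAT THIS FILE PROVES (theorems only; 0 `def`).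
* ★★ `classC0U_theta13OfThm1CC1_of_thm1RegSepCo7 (hB hB' ha₀ ha₁) (h15 : VariationalThm1RegSepCo7 F N B₃ a₀ a₁) (hmono) (hcompRev)` — at `θ₁₅ᶜᶜ¹`, for every windowed run, SEPARATED `s`, datum `𝐖` with print's (7),
  EVERY minimiser `U₀` over the displayed class (6) at `εreg` has the C⁰ bound `B₃·cR·ε_m·η_m²` on `omegaPlaqs s.Ω m` — `plaqSmallOn_of_thm1RegSepCo7` (C′ leaf) + 13b's `hnum_`∕`εreg_le_`∕
  `hcomp_…_of_monotone` + the displayed reverse clause (hcompRev).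
* ★★★ `bgAtMinimizerU_theta13OfThm1CC1_of_thm1RegSepCo7C1 (signs) (h15) (hmono) (hcompRev)` — `… → PartCompat → ∀ s hsep 𝐖 h7 U₀ hmin, C¹(s, U₀) → row body for U₀` (14c §2 ∘ ★★).
* ★★★ `bgAtMinimizerU_theta13OfThm1CC1_of_thm1RegSepCo7C1_of_betaBox (signs) (h15) (hb : 0 ≤ b) (hlow : FlowStep.BetaLowerH b ½ β₁₃(θ₁₅ᶜᶜ¹)) (hup : FlowStep.BetaUpperH β′ ½ β₁₃(θ₁₅ᶜᶜ¹)) (hβ′ : β′ ≤ 3)` —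
  (hmono) by 13e, (hcompRev) by 14d: the β-BOX LEAF (sign + printed upper bound) replaces the two history clauses.

HONEST FRAMING.  Composition of tree theorems; CONDITIONAL on the DISPLAYED named fact `VariationalThm1RegSepCo7` ([15] Thm 1 (R) over class (6), two-sided comparability — NEVER asserted), on the history
clauses resp. the β-box, and per datum on C¹(U₀); nothing of Bałaban asserted; NOT a discharge; K0⁗∕K0⁵ NOT closed; counts unmoved (typed 28∕28 · discharged 5∕28); one finite 𝕋⁴
programme at fixed ε — NOT continuum ∕ OS ∕ mass gap ∕ Clay.  No `sorry`, `axiom`, `def`, `instance`, `notation`.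
-/

noncomputable section

open MeasureTheory
open scoped Matrix.Norms.L2Operator

namespace Literature.MathematicalPhysics.QuantumFieldTheory.Balaban1983to89.Node00

open T4Continuum B14.Eq218Concrete B15DeterminingSets B12RegularSpaces111 B14RegularSpaces234 B14Radii T4AxialGaugeSmallField

section AtMinimizerUCo7

variable {F : T4Family} {N : ℕ} [NeZero N] {ε₀ ε₂₉ B₃ B₃' a₀ a₁ : ℝ}

/-- **★★ THE C⁰ CLASS BOUND AT `θ₁₅ᶜᶜ¹` FOR EVERY MINIMISER OVER PRINT'S CLASS (6), FROM THE C′ FACT `VariationalThm1RegSepCo7 F N B₃ a₀ a₁`** (two-sided comparability block) **AND THE TWO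
HISTORY CLAUSES** (hmono ⇒ `ε_m ≤ 2ε_{m+1}` by 13b; hcompRev = `ε_{m+1} ≤ 2ε_m`, FILE 14d's currency): `plaqSmallOn_of_thm1RegSepCo7` at the run objects of the witness.  CONDITIONAL; nothing
of Bałaban asserted. [cite: Balaban1985Variational, Thm 1 (2),(6)–(8) pp.278–279; Balaban1985RegularSpaces, (1.7)–(1.9) p.77; Balaban1988Convergent, (2.4)–(2.8) pp.255–256, (2.12) p.256] -/
theorem classC0U_theta13OfThm1CC1_of_thm1RegSepCo7 (hB : 0 ≤ B₃) (hB' : 0 ≤ B₃') (ha₀ : 0 < a₀) (ha₁ : 0 < a₁)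
    (h15 : VariationalThm1RegSepCo7 F N B₃ a₀ a₁)
    (hmono : ∀ (p : B12.RunParams) (n : ℕ), n ≤ p.K → Step.InInterval (theta13OfThm1CC1 F N ε₀ ε₂₉ B₃ B₃' a₀ a₁).γ n (gOfRecord₁₃ F N (theta13OfThm1CC1 F N ε₀ ε₂₉ B₃ B₃' a₀ a₁) p) → ∀ m, m < n →
      gOfRecord₁₃ F N (theta13OfThm1CC1 F N ε₀ ε₂₉ B₃ B₃' a₀ a₁) p m ≤ gOfRecord₁₃ F N (theta13OfThm1CC1 F N ε₀ ε₂₉ B₃ B₃' a₀ a₁) p (m + 1))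
    (hcompRev : ∀ (p : B12.RunParams) (n : ℕ), n ≤ p.K → Step.InInterval (theta13OfThm1CC1 F N ε₀ ε₂₉ B₃ B₃' a₀ a₁).γ n (gOfRecord₁₃ F N (theta13OfThm1CC1 F N ε₀ ε₂₉ B₃ B₃' a₀ a₁) p) → ∀ m, m < n →
      (theta13OfThm1CC1 F N ε₀ ε₂₉ B₃ B₃' a₀ a₁).s2.cR * epsOfRecord (theta13OfThm1CC1 F N ε₀ ε₂₉ B₃ B₃' a₀ a₁).ν (gOfRecord₁₃ F N (theta13OfThm1CC1 F N ε₀ ε₂₉ B₃ B₃' a₀ a₁) p) (m + 1) ≤ 2 * ((theta13OfThm1CC1 F N ε₀ ε₂₉ B₃ B₃' a₀ a₁).s2.cR * epsOfRecord (theta13OfThm1CC1 F N ε₀ ε₂₉ B₃ B₃' a₀ a₁).ν (gOfRecord₁₃ F N (theta13OfThm1CC1 F N ε₀ ε₂₉ B₃ B₃' a₀ a₁) p) m)) :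
    ∀ (p : B12.RunParams) (n : ℕ), n ≤ p.K → Step.InInterval (theta13OfThm1CC1 F N ε₀ ε₂₉ B₃ B₃' a₀ a₁).γ n (gOfRecord₁₃ F N (theta13OfThm1CC1 F N ε₀ ε₂₉ B₃ B₃' a₀ a₁) p) →
      ∀ (s : SeqOfRecord F (theta13OfThm1CC1 F N ε₀ ε₂₉ B₃ B₃' a₀ a₁).ν (theta13OfThm1CC1 F N ε₀ ε₂₉ B₃ B₃' a₀ a₁).τ9.M (gOfRecord₁₃ F N (theta13OfThm1CC1 F N ε₀ ε₂₉ B₃ B₃' a₀ a₁) p) p.K n), Sect2.SeqSeparated (theta13OfThm1CC1 F N ε₀ ε₂₉ B₃ B₃' a₀ a₁).ν.M₁ s →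
      ∀ (W : MSField (F.P p.K) (SU N)), Sect2.DataSmall7P (avOfRecord F N p.K) s.Ω n (fun j => (theta13OfThm1CC1 F N ε₀ ε₂₉ B₃ B₃' a₀ a₁).s2.cR * epsOfRecord (theta13OfThm1CC1 F N ε₀ ε₂₉ B₃ B₃' a₀ a₁).ν (gOfRecord₁₃ F N (theta13OfThm1CC1 F N ε₀ ε₂₉ B₃ B₃' a₀ a₁) p) j) W →
      ∀ (U₀ : GaugeField (F.P p.K) 0 (SU N)), IsMinimizer (avOfRecord F N p.K)
          {U | (∀ m, m ≤ n → PlaqSmallOn (omegaPlaqs s.Ω m) ((theta13OfThm1CC1 F N ε₀ ε₂₉ B₃ B₃' a₀ a₁).ν.εreg * (F.P p.K).eta m ^ 2) U) ∧ Sect2.CoDivClassOn s.Ω n (theta13OfThm1CC1 F N ε₀ ε₂₉ B₃ B₃' a₀ a₁).ν.εreg U} (genSet s.Ω n) W U₀ →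
      (∀ m, m ≤ n → PlaqSmallOn (omegaPlaqs s.Ω m) (B₃ * ((theta13OfThm1CC1 F N ε₀ ε₂₉ B₃ B₃' a₀ a₁).s2.cR * epsOfRecord (theta13OfThm1CC1 F N ε₀ ε₂₉ B₃ B₃' a₀ a₁).ν (gOfRecord₁₃ F N (theta13OfThm1CC1 F N ε₀ ε₂₉ B₃ B₃' a₀ a₁) p) m) * (F.P p.K).eta m ^ 2) U₀) :=
  fun p n hn hw s hsep _ h7 _ hmin =>
    plaqSmallOn_of_thm1RegSepCo7 h15 (theta13OfThm1CC1 F N ε₀ ε₂₉ B₃ B₃' a₀ a₁).ν (theta13OfThm1CC1 F N ε₀ ε₂₉ B₃ B₃' a₀ a₁).τ9.M (gOfRecord₁₃ F N (theta13OfThm1CC1 F N ε₀ ε₂₉ B₃ B₃' a₀ a₁) p) p.K n (theta13OfThm1CC1 F N ε₀ ε₂₉ B₃ B₃' a₀ a₁).s2.cR s hsep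
      (hnum_theta13OfThm1CC1 hB hB' ha₀ ha₁ p n hn hw) εreg_le_theta13OfThm1CC1 (hcomp_theta13OfThm1CC1_of_monotone hB hB' ha₀.le ha₁.le hmono p n hn hw) (hcompRev p n hn hw) h7 hmin

/-- **★★★ ROW P11's BODY AT `θ₁₅ᶜᶜ¹` FOR EVERY MINIMISER `U₀` OVER PRINT'S CLASS (6)** from the C′ fact (⇒ C⁰, ★★), the two history clauses and the DISPLAYED C¹ class bound for `U₀` —
FILE 14c §2 ∘ ★★.  CONDITIONAL; nothing of Bałaban asserted. [cite: Balaban1985Variational, (7) p.278, Thm 1 (2),(6)–(10) pp.278–279; Balaban1985RegularSpaces, (1.3)–(1.9) p.77; Balaban1988Convergent, (2.4)–(2.8) pp.255–256, (2.10) p.256, (2.12) p.256, (2.27)–(2.28) p.259, (2.34)–(2.41) p.261; Balaban1987RG1, (1.11)–(1.16) p.262] -/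
theorem bgAtMinimizerU_theta13OfThm1CC1_of_thm1RegSepCo7C1 (hε : 0 < ε₀) (hε' : 0 < ε₂₉) (hB : 0 ≤ B₃) (hB' : 0 ≤ B₃') (ha₀ : 0 < a₀) (ha₁ : 0 < a₁)
    (h15 : VariationalThm1RegSepCo7 F N B₃ a₀ a₁)
    (hmono : ∀ (p : B12.RunParams) (n : ℕ), n ≤ p.K → Step.InInterval (theta13OfThm1CC1 F N ε₀ ε₂₉ B₃ B₃' a₀ a₁).γ n (gOfRecord₁₃ F N (theta13OfThm1CC1 F N ε₀ ε₂₉ B₃ B₃' a₀ a₁) p) → ∀ m, m < n →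
      gOfRecord₁₃ F N (theta13OfThm1CC1 F N ε₀ ε₂₉ B₃ B₃' a₀ a₁) p m ≤ gOfRecord₁₃ F N (theta13OfThm1CC1 F N ε₀ ε₂₉ B₃ B₃' a₀ a₁) p (m + 1))
    (hcompRev : ∀ (p : B12.RunParams) (n : ℕ), n ≤ p.K → Step.InInterval (theta13OfThm1CC1 F N ε₀ ε₂₉ B₃ B₃' a₀ a₁).γ n (gOfRecord₁₃ F N (theta13OfThm1CC1 F N ε₀ ε₂₉ B₃ B₃' a₀ a₁) p) → ∀ m, m < n →
      (theta13OfThm1CC1 F N ε₀ ε₂₉ B₃ B₃' a₀ a₁).s2.cR * epsOfRecord (theta13OfThm1CC1 F N ε₀ ε₂₉ B₃ B₃' a₀ a₁).ν (gOfRecord₁₃ F N (theta13OfThm1CC1 F N ε₀ ε₂₉ B₃ B₃' a₀ a₁) p) (m + 1) ≤ 2 * ((theta13OfThm1CC1 F N ε₀ ε₂₉ B₃ B₃' a₀ a₁).s2.cR * epsOfRecord (theta13OfThm1CC1 F N ε₀ ε₂₉ B₃ B₃' a₀ a₁).ν (gOfRecord₁₃ F N (theta13OfThm1CC1 F N ε₀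 ε₂₉ B₃ B₃' a₀ a₁) p) m)) :
    ∀ (p : B12.RunParams) (n : ℕ), n ≤ p.K → Step.InInterval (theta13OfThm1CC1 F N ε₀ ε₂₉ B₃ B₃' a₀ a₁).γ n (gOfRecord₁₃ F N (theta13OfThm1CC1 F N ε₀ ε₂₉ B₃ B₃' a₀ a₁) p) → PartCompat₁₃ F N (theta13OfThm1CC1 F N ε₀ ε₂₉ B₃ B₃' a₀ a₁) p n →
      ∀ (s : SeqOfRecord F (theta13OfThm1CC1 F N ε₀ ε₂₉ B₃ B₃' a₀ a₁).ν (theta13OfThm1CC1 F N ε₀ ε₂₉ B₃ B₃' a₀ a₁).τ9.M (gOfRecord₁₃ F N (theta13OfThm1CC1 F N ε₀ ε₂₉ B₃ B₃' a₀ a₁) p) p.K n), Sect2.SeqSeparated (theta13OfThm1CC1 F N ε₀ ε₂₉ B₃ B₃' a₀ a₁).ν.M₁ s →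
      ∀ (W : MSField (F.P p.K) (SU N)), Sect2.DataSmall7P (avOfRecord F N p.K) s.Ω n (fun j => (theta13OfThm1CC1 F N ε₀ ε₂₉ B₃ B₃' a₀ a₁).s2.cR * epsOfRecord (theta13OfThm1CC1 F N ε₀ ε₂₉ B₃ B₃' a₀ a₁).ν (gOfRecord₁₃ F N (theta13OfThm1CC1 F N ε₀ ε₂₉ B₃ B₃' a₀ a₁) p) j) W →
      ∀ (U₀ : GaugeField (F.P p.K) 0 (SU N)), IsMinimizer (avOfRecord F N p.K)
          {U | (∀ m, m ≤ n → PlaqSmallOn (omegaPlaqs s.Ω m) ((theta13OfThm1CC1 F N ε₀ ε₂₉ B₃ B₃' a₀ a₁).ν.εreg * (F.P p.K).eta m ^ 2) U) ∧ Sect2.CoDivClassOn s.Ω n (theta13OfThm1CC1 F N ε₀ ε₂₉ B₃ B₃' a₀ a₁).ν.εreg U} (genSet s.Ω n) W U₀ →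
      (∀ m, 1 ≤ m → m ≤ n → PlaqC1SmallOn (plaqInside (s.Ω m)) (B₃' * ((theta13OfThm1CC1 F N ε₀ ε₂₉ B₃ B₃' a₀ a₁).s2.cR * epsOfRecord (theta13OfThm1CC1 F N ε₀ ε₂₉ B₃ B₃' a₀ a₁).ν (gOfRecord₁₃ F N (theta13OfThm1CC1 F N ε₀ ε₂₉ B₃ B₃' a₀ a₁) p) m) * (F.P p.K).eta m ^ 3) U₀) →
      ∀ j, 1 ≤ j → j ≤ n → ∀ X : (Sect2.domSys (F.P p.K) (theta13OfThm1CC1 F N ε₀ ε₂₉ B₃ B₃' a₀ a₁).τ9.M j).Dom,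
      (Sect2.domSites (F.P p.K) (theta13OfThm1CC1 F N ε₀ ε₂₉ B₃ B₃' a₀ a₁).τ9.M j X ⊆ s.Λ j →
        Sect2.ofBackgroundC (settingOfRecord₁₃ F N (theta13OfThm1CC1 F N ε₀ ε₂₉ B₃ B₃' a₀ a₁) p).ι U₀ ∈
          Sect2.spaceI (settingOfRecord₁₃ F N (theta13OfThm1CC1 F N ε₀ ε₂₉ B₃ B₃' a₀ a₁) p) ((theta13OfThm1CC1 F N ε₀ ε₂₉ B₃ B₃' a₀ a₁).Rz p.K) (theta13OfThm1CC1 F N ε₀ ε₂₉ B₃ B₃' a₀ a₁).τ9.M j (Sect2.domSites (F.P p.K) (theta13OfThm1CC1 F N ε₀ ε₂₉ B₃ B₃' a₀ a₁).τ9.M j X)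
            ((settingOfRecord₁₃ F N (theta13OfThm1CC1 F N ε₀ ε₂₉ B₃ B₃' a₀ a₁) p).lf.alpha0 ((settingOfRecord₁₃ F N (theta13OfThm1CC1 F N ε₀ ε₂₉ B₃ B₃' a₀ a₁) p).flow.g j)) ((settingOfRecord₁₃ F N (theta13OfThm1CC1 F N ε₀ ε₂₉ B₃ B₃' a₀ a₁) p).lf.alpha1 ((settingOfRecord₁₃ F N (theta13OfThm1CC1 F N ε₀ ε₂₉ B₃ B₃' a₀ a₁) p).flow.g j))) ∧
      (Sect2.admB (F.P p.K) (theta13OfThm1CC1 F N ε₀ ε₂₉ B₃ B₃' a₀ a₁).ν (theta13OfThm1CC1 F N ε₀ ε₂₉ B₃ B₃' a₀ a₁).τ9.M (gOfRecord₁₃ F N (theta13OfThm1CC1 F N ε₀ ε₂₉ B₃ B₃' a₀ a₁) p) s.Ω s.Λ j (Sect2.domSites (F.P p.K) (theta13OfThm1CC1 F N ε₀ ε₂₉ B₃ B₃' a₀ a₁).τ9.M j X) = true →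
        Sect2.ofBackgroundC (settingOfRecord₁₃ F N (theta13OfThm1CC1 F N ε₀ ε₂₉ B₃ B₃' a₀ a₁) p).ι U₀ ∈
          Sect2.spaceMS (settingOfRecord₁₃ F N (theta13OfThm1CC1 F N ε₀ ε₂₉ B₃ B₃' a₀ a₁) p) ((theta13OfThm1CC1 F N ε₀ ε₂₉ B₃ B₃' a₀ a₁).Rz p.K) (theta13OfThm1CC1 F N ε₀ ε₂₉ B₃ B₃' a₀ a₁).τ9.M j (Sect2.domSites (F.P p.K) (theta13OfThm1CC1 F N ε₀ ε₂₉ B₃ B₃' a₀ a₁).τ9.M j X) s.Ω) :=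
  fun p n hn hw hpc s hsep W h7 U₀ hmin hC1U =>
    bgAtDatumU_theta13OfThm1CC1_of_pos hε hε' hB hB' ha₀ ha₁ p n hn hw hpc s U₀
      (classC0U_theta13OfThm1CC1_of_thm1RegSepCo7 hB hB' ha₀ ha₁ h15 hmono hcompRev p n hn hw s hsep W h7 U₀ hmin) hC1U

/-- **★★★ THE SAME WITH BOTH HISTORY CLAUSES FROM THE β-BOX LEAF** `b ≤ β₁₃(θ₁₅ᶜᶜ¹) ≤ β′` on `]0, ½]`, `0 ≤ b`, `β′ ≤ 3` ((hmono) by FILE 13e `hmono_theta13OfThm1CC1_of_betaLowerH`, (hcompRev) by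
FILE 14d `hcompRev_theta13OfThm1CC1_of_betaBox`).  CONDITIONAL; nothing of Bałaban asserted. [cite: Balaban1985Variational, Thm 1 (6)–(10) pp.278–279; Balaban1987RG1, (0.20) p.256, Thm 2 p.259, §1 p.264; Balaban1988Convergent, (2.4)–(2.8) pp.255–256, (2.27)–(2.28) p.259, (2.34)–(2.41) p.261] -/
theorem bgAtMinimizerU_theta13OfThm1CC1_of_thm1RegSepCo7C1_of_betaBox (hε : 0 < ε₀) (hε' : 0 < ε₂₉) (hB : 0 ≤ B₃) (hB' : 0 ≤ B₃') (ha₀ : 0 < a₀) (ha₁ : 0 < a₁)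
    (h15 : VariationalThm1RegSepCo7 F N B₃ a₀ a₁)
    {b β' : ℝ} (hb : 0 ≤ b) (hlow : FlowStep.BetaLowerH b (1 / 2) (betaOfRecord₁₃ F N (theta13OfThm1CC1 F N ε₀ ε₂₉ B₃ B₃' a₀ a₁)))
    (hup : FlowStep.BetaUpperH β' (1 / 2) (betaOfRecord₁₃ F N (theta13OfThm1CC1 F N ε₀ ε₂₉ B₃ B₃' a₀ a₁))) (hβ' : β' ≤ 3) :
    ∀ (p : B12.RunParams) (n : ℕ), n ≤ p.K → Step.InInterval (theta13OfThm1CC1 F N ε₀ ε₂₉ B₃ B₃' a₀ a₁).γ n (gOfRecord₁₃ F N (theta13OfThm1CC1 F N ε₀ ε₂₉ B₃ B₃' a₀ a₁) p) → PartCompat₁₃ F N (theta13OfThm1CC1 F N ε₀ ε₂₉ B₃ B₃' a₀ a₁) p n →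
      ∀ (s : SeqOfRecord F (theta13OfThm1CC1 F N ε₀ ε₂₉ B₃ B₃' a₀ a₁).ν (theta13OfThm1CC1 F N ε₀ ε₂₉ B₃ B₃' a₀ a₁).τ9.M (gOfRecord₁₃ F N (theta13OfThm1CC1 F N ε₀ ε₂₉ B₃ B₃' a₀ a₁) p) p.K n), Sect2.SeqSeparated (theta13OfThm1CC1 F N ε₀ ε₂₉ B₃ B₃' a₀ a₁).ν.M₁ s →
      ∀ (W : MSField (F.P p.K) (SU N)), Sect2.DataSmall7P (avOfRecord F N p.K) s.Ω n (fun j => (theta13OfThm1CC1 F N ε₀ ε₂₉ B₃ B₃' a₀ a₁).s2.cR * epsOfRecord (theta13OfThm1CC1 F N ε₀ ε₂₉ B₃ B₃' a₀ a₁).ν (gOfRecord₁₃ F N (theta13OfThm1CC1 F N ε₀ ε₂₉ B₃ B₃' a₀ a₁) p) j) W →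
      ∀ (U₀ : GaugeField (F.P p.K) 0 (SU N)), IsMinimizer (avOfRecord F N p.K)
          {U | (∀ m, m ≤ n → PlaqSmallOn (omegaPlaqs s.Ω m) ((theta13OfThm1CC1 F N ε₀ ε₂₉ B₃ B₃' a₀ a₁).ν.εreg * (F.P p.K).eta m ^ 2) U) ∧ Sect2.CoDivClassOn s.Ω n (theta13OfThm1CC1 F N ε₀ ε₂₉ B₃ B₃' a₀ a₁).ν.εreg U} (genSet s.Ω n) W U₀ →
      (∀ m, 1 ≤ m → m ≤ n → PlaqC1SmallOn (plaqInside (s.Ω m)) (B₃' * ((theta13OfThm1CC1 F N ε₀ ε₂₉ B₃ B₃' a₀ a₁).s2.cR * epsOfRecord (theta13OfThm1CC1 F N ε₀ ε₂₉ B₃ B₃' a₀ a₁).ν (gOfRecord₁₃ F N (theta13OfThm1CC1 F N ε₀ ε₂₉ B₃ B₃' a₀ a₁) p) m) * (F.P p.K).eta m ^ 3) U₀) →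
      ∀ j, 1 ≤ j → j ≤ n → ∀ X : (Sect2.domSys (F.P p.K) (theta13OfThm1CC1 F N ε₀ ε₂₉ B₃ B₃' a₀ a₁).τ9.M j).Dom,
      (Sect2.domSites (F.P p.K) (theta13OfThm1CC1 F N ε₀ ε₂₉ B₃ B₃' a₀ a₁).τ9.M j X ⊆ s.Λ j →
        Sect2.ofBackgroundC (settingOfRecord₁₃ F N (theta13OfThm1CC1 F N ε₀ ε₂₉ B₃ B₃' a₀ a₁) p).ι U₀ ∈
          Sect2.spaceI (settingOfRecord₁₃ F N (theta13OfThm1CC1 F N ε₀ ε₂₉ B₃ B₃' a₀ a₁) p) ((theta13OfThm1CC1 F N ε₀ ε₂₉ B₃ B₃' a₀ a₁).Rz p.K) (theta13OfThm1CC1 F N ε₀ ε₂₉ B₃ B₃' a₀ a₁).τ9.M j (Sect2.domSites (F.P p.K) (theta13OfThm1CC1 F N ε₀ ε₂₉ B₃ B₃' a₀ a₁).τ9.M j X)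
            ((settingOfRecord₁₃ F N (theta13OfThm1CC1 F N ε₀ ε₂₉ B₃ B₃' a₀ a₁) p).lf.alpha0 ((settingOfRecord₁₃ F N (theta13OfThm1CC1 F N ε₀ ε₂₉ B₃ B₃' a₀ a₁) p).flow.g j)) ((settingOfRecord₁₃ F N (theta13OfThm1CC1 F N ε₀ ε₂₉ B₃ B₃' a₀ a₁) p).lf.alpha1 ((settingOfRecord₁₃ F N (theta13OfThm1CC1 F N ε₀ ε₂₉ B₃ B₃' a₀ a₁) p).flow.g j))) ∧
      (Sect2.admB (F.P p.K) (theta13OfThm1CC1 F N ε₀ ε₂₉ B₃ B₃' a₀ a₁).ν (theta13OfThm1CC1 F N ε₀ ε₂₉ B₃ B₃' a₀ a₁).τ9.M (gOfRecord₁₃ F N (theta13OfThm1CC1 F N ε₀ ε₂₉ B₃ B₃' a₀ a₁) p) s.Ω s.Λ j (Sect2.domSites (F.P p.K) (theta13OfThm1CC1 F N ε₀ ε₂₉ B₃ B₃' a₀ a₁).τ9.M j X) = true →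
        Sect2.ofBackgroundC (settingOfRecord₁₃ F N (theta13OfThm1CC1 F N ε₀ ε₂₉ B₃ B₃' a₀ a₁) p).ι U₀ ∈
          Sect2.spaceMS (settingOfRecord₁₃ F N (theta13OfThm1CC1 F N ε₀ ε₂₉ B₃ B₃' a₀ a₁) p) ((theta13OfThm1CC1 F N ε₀ ε₂₉ B₃ B₃' a₀ a₁).Rz p.K) (theta13OfThm1CC1 F N ε₀ ε₂₉ B₃ B₃' a₀ a₁).τ9.M j (Sect2.domSites (F.P p.K) (theta13OfThm1CC1 F N ε₀ ε₂₉ B₃ B₃' a₀ a₁).τ9.M j X) s.Ω) :=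
  bgAtMinimizerU_theta13OfThm1CC1_of_thm1RegSepCo7C1 hε hε' hB hB' ha₀ ha₁ h15 (hmono_theta13OfThm1CC1_of_betaLowerH hb hlow)
    (hcompRev_theta13OfThm1CC1_of_betaBox hB hB' ha₀.le ha₁.le hb hlow hup hβ')

end AtMinimizerUCo7

end Literature.MathematicalPhysics.QuantumFieldTheory.Balaban1983to89.Node00

end
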